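import Mathlib
import Summits.MatrixMultiplication.MatrixMultiplication.Theorems.SnSubsetDichotomyPolynomialSlackMatchingExtract

/-!
# A scattered matching in the two-dense endgame

Crux `Summit.MatrixMultiplication.MatrixMultiplication.Theses.SnSubsetDichotomy.PolynomialSlack`
(item `stmt-MatrixMultiplication-8306`), level-one programme, lead c8 (two dense quotients, matching branch:
a scattered matching).

In the two-dense endgame `p k i ≥ 0` is the heavy mass of the sparse quotient at the cell `(k, i)` (total mass
`≥ 3/4`, every row sum and every column sum `≤ τ`) and `c k i ≥ 0` is a collision weight with
`Σ p·c ≤ ε/4`.  The cells with `p > 0` and `c ≤ ε` carry mass `≥ 1/2` (the cells with `c > ε` carry at most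
`(1/ε)·Σ p·c ≤ 1/4`), so the matching extraction lemma `exists_matching_of_small_degrees` yields a matching of
such cells with at least `1/(4τ)` elements.
-/

namespace Summit.MatrixMultiplication.MatrixMultiplication.Theorems.PolynomialSlack

set_option linter.dupNamespace false

open scoped BigOperators

/-- Pointwise form of the mass estimate: `p ≤ 𝟙[0 < p ∧ c ≤ ε]·p + p·c/ε` for `p, c ≥ 0` and `ε > 0`.
[folklore] -/
private theorem scatteredMatching_pointwise (p c ε : ℝ) (hε : 0 < ε) (hp : 0 ≤ p) (hc : 0 ≤ c) :
    p ≤ (if 0 < p ∧ c ≤ ε then p else 0) + p * c / ε := by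
  by_cases h : 0 < p ∧ c ≤ ε
  · rw [if_pos h]
    have : 0 ≤ p * c / ε := div_nonneg (mul_nonneg hp hc) hε.le
    linarith
  · rw [if_neg h, zero_add]
    rcases not_and_or.mp h with h1 | h2
    · have hp' : p = 0 := le_antisymm (not_lt.mp h1) hp
      rw [hp', zero_mul, zero_div]
    · rw [le_div_iff₀ hε]
      exact mul_le_mul_of_nonneg_left (le_of_lt (not_le.mp h2)) hp

/-- Mass of the scattered cells: if `Σ p ≥ 3/4` and `Σ p·c ≤ ε/4` with `p, c ≥ 0`, then the cells with
`p > 0` and `c ≤ ε` carry mass `≥ 1/2`. [folklore] -/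
private theorem scatteredMatching_mass_ge {α β : Type*} [Fintype α] [Fintype β]
    (p c : α → β → ℝ) (ε : ℝ) (hε : 0 < ε)
    (hp0 : ∀ k i, 0 ≤ p k i) (hc0 : ∀ k i, 0 ≤ c k i)
    (hW : 3 / 4 ≤ ∑ k, ∑ i, p k i) (hΦ : ∑ k, ∑ i, p k i * c k i ≤ ε / 4) :
    1 / 2 ≤ ∑ e ∈ Finset.univ.filter (fun e : α × β => 0 < p e.1 e.2 ∧ c e.1 e.2 ≤ ε), p e.1 e.2 := by
  have h1 : ∑ e : α × β, p e.1 e.2 = ∑ k, ∑ i, p k i := Fintype.sum_prod_type' p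
  have h2 : ∑ e : α × β, p e.1 e.2 * c e.1 e.2 = ∑ k, ∑ i, p k i * c k i :=
    Fintype.sum_prod_type' fun k i => p k i * c k i
  have h3 : ∑ e : α × β, p e.1 e.2 ≤
      ∑ e ∈ Finset.univ.filter (fun e : α × β => 0 < p e.1 e.2 ∧ c e.1 e.2 ≤ ε), p e.1 e.2
        + (∑ e : α × β, p e.1 e.2 * c e.1 e.2) / ε := by
    rw [Finset.sum_filter, Finset.sum_div, ← Finset.sum_add_distrib]
    exact Finset.sum_le_sum fun e _ =>
      scatteredMatching_pointwise (p e.1 e.2) (c e.1 e.2) ε hε (hp0 _ _) (hc0 _ _)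
  have h4 : (∑ e : α × β, p e.1 e.2 * c e.1 e.2) / ε ≤ 1 / 4 := by
    rw [div_le_iff₀ hε, h2]
    linarith
  rw [h1] at h3
  linarith

/-- Row sums over a set of cells are bounded by full row sums (nonnegative weights). [folklore] -/
private theorem scatteredMatching_row_le {α β : Type*} [Fintype α] [Fintype β] [DecidableEq α]
    (p : α → β → ℝ) (hp0 : ∀ k i, 0 ≤ p k i) (H : Finset (α × β)) (a : α) :
    ∑ e ∈ H.filter (fun e => e.1 = a), p e.1 e.2 ≤ ∑ i, p a i := by
  calc ∑ e ∈ H.filter (fun e => e.1 = a), p e.1 e.2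
      ≤ ∑ e ∈ Finset.univ.filter (fun e : α × β => e.1 = a), p e.1 e.2 :=
        Finset.sum_le_sum_of_subset_of_nonneg (Finset.filter_subset_filter _ (Finset.subset_univ H))
          fun e _ _ => hp0 _ _
    _ = ∑ i, p a i := by
        rw [Finset.sum_filter, Fintype.sum_prod_type]
        simp only [Finset.sum_ite_irrel, Finset.sum_const_zero, Finset.sum_ite_eq', Finset.mem_univ,
          if_true]

/-- Column sums over a set of cells are bounded by full column sums (nonnegative weights). [folklore] -/
private theorem scatteredMatching_col_le {α β : Type*} [Fintype α] [Fintype β] [DecidableEq β]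
    (p : α → β → ℝ) (hp0 : ∀ k i, 0 ≤ p k i) (H : Finset (α × β)) (b : β) :
    ∑ e ∈ H.filter (fun e => e.2 = b), p e.1 e.2 ≤ ∑ k, p k b := by
  calc ∑ e ∈ H.filter (fun e => e.2 = b), p e.1 e.2
      ≤ ∑ e ∈ Finset.univ.filter (fun e : α × β => e.2 = b), p e.1 e.2 :=
        Finset.sum_le_sum_of_subset_of_nonneg (Finset.filter_subset_filter _ (Finset.subset_univ H))
          fun e _ _ => hp0 _ _
    _ = ∑ k, p k b := by
        rw [Finset.sum_filter, Fintype.sum_prod_type_right]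
        simp only [Finset.sum_ite_irrel, Finset.sum_const_zero, Finset.sum_ite_eq', Finset.mem_univ,
          if_true]

/-- **Scattered matching (TD2a).** In the two-dense endgame, with heavy masses `p k i ≥ 0` of total `≥ 3/4`,
row and column sums `≤ τ`, and collision weights `c k i ≥ 0` with `Σ p·c ≤ ε/4`, there is a matching (no two
cells share a row `k` or a column `i`) of at least `1/(4τ)` cells, each with `p > 0` and `c ≤ ε`: the cells
with `p > 0, c ≤ ε` carry mass `≥ 3/4 - 1/4 = 1/2`, and `exists_matching_of_small_degrees` extracts from them
a matching `M` with `1/2 ≤ 2·|M|·τ`. [folklore] -/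
theorem exists_scattered_matching {α β : Type*} [Fintype α] [Fintype β] [DecidableEq α] [DecidableEq β]
    (p c : α → β → ℝ) (τ ε : ℝ) (hτ : 0 < τ) (hε : 0 < ε)
    (hp0 : ∀ k i, 0 ≤ p k i) (hc0 : ∀ k i, 0 ≤ c k i)
    (hrow : ∀ k, ∑ i, p k i ≤ τ) (hcol : ∀ i, ∑ k, p k i ≤ τ)
    (hW : 3 / 4 ≤ ∑ k, ∑ i, p k i) (hΦ : ∑ k, ∑ i, p k i * c k i ≤ ε / 4) :
    ∃ Mt : Finset (α × β), Set.InjOn Prod.fst (Mt : Set (α × β)) ∧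
      Set.InjOn Prod.snd (Mt : Set (α × β)) ∧
      (∀ e ∈ Mt, 0 < p e.1 e.2 ∧ c e.1 e.2 ≤ ε) ∧ 1 / (4 * τ) ≤ (Mt.card : ℝ) := by
  have hmass := scatteredMatching_mass_ge p c ε hε hp0 hc0 hW hΦ
  obtain ⟨M, hMH, hM1, hM2, hsum⟩ := exists_matching_of_small_degrees
    (Finset.univ.filter (fun e : α × β => 0 < p e.1 e.2 ∧ c e.1 e.2 ≤ ε)) (fun e => p e.1 e.2)
    (fun e _ => hp0 e.1 e.2) τ
    (fun a => (scatteredMatching_row_le p hp0 _ a).trans (hrow a))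
    (fun b => (scatteredMatching_col_le p hp0 _ b).trans (hcol b))
  refine ⟨M, hM1, hM2, fun e he => (Finset.mem_filter.mp (hMH he)).2, ?_⟩
  rw [div_le_iff₀ (by positivity)]
  linarith

end Summit.MatrixMultiplication.MatrixMultiplication.Theorems.PolynomialSlack
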